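import Summits.QuantumFields.YangMills.Theorems.BalabanUVNodesN08AtRecord13Family
import Literature.MathematicalPhysics.QuantumFieldTheory.Balaban1983to89.Node00.Record13CarriersSep

/-!
# BalabanUVNodes ∕ N08 AT THE SEPARATED-RANGE STAGE-13 RECORD OF RECORD — the rev-18 re-key of N08's ₁₃ ∃-currency at def-T's `Record13` v1.2 (p501191:
# `Stage13Params.Provisos₁₃Sep`, `datumOfRecord₁₃Sep`, `IsRecordOfRecord₁₃CSep` — row P11 `bg` now on the SEPARATED support `suppOfRecord₁₃Sep` and the
# torus-compatible run range `PartCompat₁₃`, director-ym №136–№139, plan g67 ACK-138 ∕ WORD-T2 ∕ WORD-139) over dag-n10-d's separated-range carrier twins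
# (`Provisos₁₃Sep.pinB10 ∕ pinY ∕ pinZ ∕ pinW`, `datumOfRecord₁₃Sep_pin<G>`, `isRecordOfRecord₁₃CSep_pinB10_of_eq`, the leaf `Node00/Record13CarriersSep` p502304) and
# node00-def-K0a's HYPOTHESIS-FREE row P12 at the witness families (`slotsNondegenerate₁₃_…_of_hasResiduals`, `Node00/Record13LiveSelectorFamily` v1.1)
# (Track A, DAG node N08 [Balaban1985UV3] CMP **102** (1985) 255, Thm 1 p. 257 (compact reading) + Thm 2 p. 272; R134 fan-out seat `pub-ymgap-dag-n08-c` g10,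
# strategy s2 «knit at the record of record», trigger (t19) = the rev-18 separated-range re-key, 2026-08-27)

WHY THIS FILE.  The rev-18 items of route «BalabanUVNodes» are keyed on the separated-range record: the K0⁗ text reads `θ.Provisos₁₃Sep F 2`, the K1⁗ rung 1
(plan's skeleton v2 `NodesAtSomeRecord13P`) reads `IsRecordOfRecord₁₃CSep F 2 (datumOfRecord₁₃Sep F 2 θ h) w` AND PINS NODE N08 BY NAME as the conjunct
`Node00.PrintedUV3V 2 θ.L` (referee dag-ref-C READ185 AUDIT A2: at an unpinned ₁₃ record the [B10] run family may be re-bound empty).  This seat's ₁₃ storey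
`BalabanUVNodesN08AtRecord13` (p491313) and its witness-family module `…Family` (p494431) are keyed on the now-deprecated `Provisos₁₃ ∕ datumOfRecord₁₃ ∕
IsRecordOfRecord₁₃C`; a ‴-keyed theorem is NOT instantiable from `h : θ.Provisos₁₃Sep F N` (the map `Provisos₁₃.toSep` goes old ⇒ new only).  So the ∃-CURRENCY —
and only it — is re-typed here under def-T's token map; the POINTED closers (p491313 §1, p489533 `N08AtStage5View`) are proviso-free and serve verbatim.

WHAT IS PROVED (all bookkeeping BY NAME, one `exact`∕`obtain` each):
* §0 the in-edge guards `b4 b5 b6 b7` at every run of every ₁₃CSep record (def-T's `atWorld_of_isRecordOfRecord₁₃CSep`), hence N08 there reads `b8 → b9 → b11 → b10`;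
* §0b the separated-range record over the [B10]-PINNED and over the FOUR-PIN Stage-13 view at `datumOfRecord₁₃Sep θ h` (n10-d's `Provisos₁₃Sep.pin<G>`,
  `datumOfRecord₁₃Sep_pin<G>`, `isRecordOfRecord₁₃CSep_pinB10_of_eq`), and their existence at any window `0 < γw ≤ θ.γ`;
* §2 THE ⁗ ∃-CURRENCY: from `θ`, `h : θ.Provisos₁₃Sep F N`, admissibility and `PrintedUV3V N θ.L` — a world that IS a ₁₃CSep record of `datumOfRecord₁₃Sep θ h`, bound
  over the pinned ∕ four-pin view, carrying N08 at every run; the PINNED and FOUR-PIN PRESENTATIONS (same datum, guard and admissibility read AT the presenting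
  parameter); and «K0⁗'s antecedent `∃ θ, Provisos₁₃Sep ∧ (ZtUnity ∧ SlotsNondegenerate₁₃) ∧ Admissible` + the slot at every odd `L > 1` ⟹ N08's conjunct of
  rung 1 v2 WITH ITS PIN `PrintedUV3V N θ.L`» (`…_of_inhabited13Sep`, `_two` at `N = 2` = the ⁗ text verbatim), plus the bridge from the ‴ antecedent (`.toSep`);
* §3 on the WITNESS LINE OF RECORD `θ₁₃ = theta13LiveOfRecord F N` (`L = F.L`, `γ = 1∕2`): N08's share costs `hP : θ₁₃.Provisos₁₃Sep F N` (HYPOTHESIS) +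
  `PrintedUV3V N F.L`; the guard is K0a's `ztUnity_theta13LiveOfRecord` ∕ HYPOTHESIS-FREE `slotsNondegenerate₁₃_theta13LiveOfRecord_of_hasResiduals`;
* §4 the same at K0a's all-numerics family `theta13LiveOfNumerics n ε₂₉ …` (`γ = n.γ`) and two-letter family `theta13LiveOfFamily₂ ε₀ ε₂₉ …` (`γ = 1∕2`), the
  members the K0⁗ rungs choose — provisos OPAQUE (`hP : ….Provisos₁₃Sep F N`; no `bg` socket text here: K0a's separated-range socket is FILE 12's, not this seat's).

HONEST FRAMING.  Count-neutral kernel bookkeeping BY NAME — the token-map twin (`Provisos₁₃ ↦ Provisos₁₃Sep`, `datumOfRecord₁₃ ↦ datumOfRecord₁₃Sep`,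
`IsRecordOfRecord₁₃C ↦ IsRecordOfRecord₁₃CSep`) of p491313 §0∕§0b∕§2∕§3 and p494431 §1∕§2.  NOT A DISCHARGE OF N08: `PrintedUV3V` is TYPED and DISPLAYED as a
hypothesis (resp. carried as the pin), NOT PROVED — an inhabitant (the [B10] cluster expansion at print's run objects) remains THE object gap; `Provisos₁₃Sep`,
admissibility and the guard are hypotheses or K0a's theorems, never asserted; K0⁗ ∕ K1⁗ neither proved nor assumed; nothing of Bałaban's asserted; one finite
four-torus per run at fixed `ε`, [B10]'s d = 3 lattices inside the record; nothing continuum ∕ ℝ⁴ ∕ OS ∕ mass gap ∕ Clay.  0 `sorry`, 0 `def`, standard axioms.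
Sources: [Balaban1985UV3] Thm 1 p.257, Thm 2 p.272; [Balaban1989LargeFieldII] Thm 1 + (0.1) pp.355–356; [Balaban1988Convergent] (2.28) p.259, (3.16)–(3.22)
pp.268–269; [Balaban1985RegularSpaces] (1.3)–(1.6) p.77 (separated sequences); [Balaban1987RG1] (0.21) p.256, p.257 (compatible partitions), (2.9) p.266.
-/

noncomputable section

namespace Summit.QuantumFields.YangMills.BalabanUVNodes.N08AtRecord13Sep

open Literature.MathematicalPhysics.QuantumFieldTheory.Balaban1983to89
open Literature.MathematicalPhysics.QuantumFieldTheory.Balaban1983to89.T4Continuum (T4Family FiniteEpsData)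
open Literature.MathematicalPhysics.QuantumFieldTheory.Balaban1983to89.DagBinding
  (WorldP leavesP PrintedCarriersR PrintedCarriers9X PrintedCarriers11 PrintedCarriers15)
open Literature.MathematicalPhysics.QuantumFieldTheory.Balaban1983to89.Node00
open Summit.QuantumFields.YangMills.BalabanUVNodes.N08AtRecord13
open scoped Matrix.Norms.L2Operator

variable {F : T4Family} {N : ℕ} [NeZero N]

/-! ## §0 THE IN-EDGE GUARDS AT EVERY RUN OF EVERY SEPARATED-RANGE STAGE-13 RECORD -/

section Guards
variable {D : FiniteEpsData F (SU N)} {w : WorldP}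

/-- **In-edge guards at every run of a ₁₃CSep record**: the leaves `b4`, `b5`, `b6`, `b7` HOLD — N01 ∕ N02 ∕ N03 ∕ N04 are NODE 00 theorems at the Stage-5 shadow
(`Node00.b4∕b5∕b7_main_of_isRecordOfRecord₅C`, `Node00.N03_at_record₅C`), transferred by def-T's v1.2 `Node00.atWorld_of_isRecordOfRecord₁₃CSep` (p491313 §0, re-keyed).
[cite: Balaban1983RegularityDecay, Theorem p.573; Balaban1984PropagatorsI, Props. 1.1–1.2 pp.33–36; Balaban1984PropagatorsII, Lemma 2.1 – Cor. 2.8 pp.234–249; Balaban1985Averaging, Props. 1–10 pp.26–50 (kernel versions at the objects of record; bookkeeping, transferred)] -/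
theorem guards_of_isRecordOfRecord₁₃CSep (h : IsRecordOfRecord₁₃CSep F N D w) (P : B12.RunParams) :
    (leavesP w P).b4 ∧ (leavesP w P).b5 ∧ (leavesP w P).b6 ∧ (leavesP w P).b7 :=
  atWorld_of_isRecordOfRecord₁₃CSep (X := fun ℓ => ℓ.b4 ∧ ℓ.b5 ∧ ℓ.b6 ∧ ℓ.b7)
    (fun _ _ h5 Q =>
      have h4 := b4_main_of_isRecordOfRecord₅C h5 Q
      have hb5 := b5_main_of_isRecordOfRecord₅C h5 Q h4
      ⟨h4, hb5, N03_at_record₅C h5 Q h4 hb5, b7_main_of_isRecordOfRecord₅C h5 Q hb5⟩)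
    h P

/-- Hence at a ₁₃CSep record N08 reads `b8 → b9 → b11 → b10` (the in-edges `b5 b6 b7` drop out). [cite: Balaban1985UV3, Thm 1 p.257, Thm 2 p.272 (bookkeeping)] -/
theorem b10_main_iff_residual_of_isRecordOfRecord₁₃CSep (h : IsRecordOfRecord₁₃CSep F N D w) (P : B12.RunParams) :
    Dag.B10_main (leavesP w P) ↔ ((leavesP w P).b8 → (leavesP w P).b9 → (leavesP w P).b11 → (leavesP w P).b10) := by
  obtain ⟨-, h5, h6, h7⟩ := guards_of_isRecordOfRecord₁₃CSep h P
  exact ⟨fun H h8 h9 h11 => H h5 h6 h7 h8 h9 h11, fun H _ _ _ h8 h9 h11 => H h8 h9 h11⟩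

end Guards

/-! ## §0b THE SEPARATED-RANGE RECORD OVER THE [B10]-PINNED ∕ FOUR-PIN STAGE-13 VIEW, over dag-n10-d's leaf `Node00/Record13CarriersSep` (p502304) separated-range twins
(`Provisos₁₃Sep.pin<G>`, `datumOfRecord₁₃Sep_pin<G>`, `isRecordOfRecord₁₃CSep_pinB10_of_eq`) BY NAME; the guard and admissibility faces per pin are θ-level
(p491313 §0b `guard_pin<G>_iff`, n10-d `Stage13Params.pin<G>_admissible_iff`, all `Iff.rfl`) and serve verbatim -/

section PinFaces
variable (θ : Stage13Params F N)

/-- **EVERY admissible Stage-13 parameter with SEPARATED-RANGE provisos presents a ₁₃CSep record at its own datum whose world is bound over the [B10]-PINNED view**,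
any window `0 < γw ≤ θ.γ`, block size `θ.L` (def-T's v1.2 world construction at `θ.pinB10`, through n10-d's `isRecordOfRecord₁₃CSep_pinB10_of_eq`). [cite: Balaban1989LargeFieldII, Thm 1 + (0.1) pp.355–356 (bookkeeping)] -/
theorem exists_world_isRecordOfRecord₁₃CSep_pinB10 (h : θ.Provisos₁₃Sep F N) (hθ : θ.Admissible F N) {γw : ℝ} (hγw : 0 < γw ∧ γw ≤ θ.γ) :
    ∃ w : WorldP, IsRecordOfRecord₁₃CSep F N (datumOfRecord₁₃Sep F N θ h) w ∧ w.γ = γw ∧ w.L = (θ.L : ℝ) ∧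
      ∀ P, w.up P = upOfRecord₅C F N ((θ.pinB10 F N).toStage5₁₃ F N) P := by
  obtain ⟨w₀⟩ := nonempty_worldP
  exact ⟨{ w₀ with
      C := (datumOfRecord₁₃Sep F N θ h).C, γ := γw, L := (θ.L : ℝ), one_lt_L := by exact_mod_cast θ.hL.2,
      up := fun P => upOfRecord₅C F N ((θ.pinB10 F N).toStage5₁₃ F N) P },
    isRecordOfRecord₁₃CSep_pinB10_of_eq F N θ h hθ _ rfl hγw rfl (fun _ => rfl), rfl, rfl, fun _ => rfl⟩

/-- **A world with def-T's pointed clauses bound over n10-d's FOUR-PIN Stage-13 view IS a ₁₃CSep record AT `datumOfRecord₁₃Sep θ h`** (presenting parameter the quadruply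
pinned `θ`; separated-range provisos transported pin by pin, datum by the four `rfl`s, view by `view₁₃B10YZW_eq` — p491313 §0b re-keyed).
[cite: Balaban1989LargeFieldII, Thm 1 + (0.1) pp.355–356 (bookkeeping)] -/
theorem isRecordOfRecord₁₃CSep_view₁₃B10YZW_of_eq (h : θ.Provisos₁₃Sep F N) (hθ : θ.Admissible F N) (Mstar : ℕ) (ops : OpsY N θ.toStage3Params Mstar)
    (ζ : ResidZ F N) (lamW : ResidW F N) (w : WorldP) (hC : w.C = (datumOfRecord₁₃Sep F N θ h).C) (hγ : 0 < w.γ ∧ w.γ ≤ θ.γ) (hL : w.L = (θ.L : ℝ))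
    (hup : ∀ P, w.up P = upOfRecord₅C F N (θ.view₁₃B10YZW F N Mstar ops ζ lamW) P) :
    IsRecordOfRecord₁₃CSep F N (datumOfRecord₁₃Sep F N θ h) w := by
  have h₁ : (θ.pinB10 F N).Provisos₁₃Sep F N := h.pinB10
  have h₂ : ((θ.pinB10 F N).pinY F N (Y9OfRecord N θ.toStage3Params Mstar ops)).Provisos₁₃Sep F N := h₁.pinY _
  have h₃ : (((θ.pinB10 F N).pinY F N (Y9OfRecord N θ.toStage3Params Mstar ops)).pinZ F N (Z11OfRecord F N ζ)).Provisos₁₃Sep F N := h₂.pinZ _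
  have h₄ : ((((θ.pinB10 F N).pinY F N (Y9OfRecord N θ.toStage3Params Mstar ops)).pinZ F N (Z11OfRecord F N ζ)).pinW F N (WOfRecord₁₃ F N θ lamW)).Provisos₁₃Sep F N :=
    h₃.pinW _
  have hθ' : ((((θ.pinB10 F N).pinY F N (Y9OfRecord N θ.toStage3Params Mstar ops)).pinZ F N (Z11OfRecord F N ζ)).pinW F N (WOfRecord₁₃ F N θ lamW)).Admissible F N :=
    (Stage13Params.pinW_admissible_iff F N _ _).2 ((Stage13Params.pinZ_admissible_iff F N _ _).2
      ((Stage13Params.pinY_admissible_iff F N _ _).2 ((Stage13Params.pinB10_admissible_iff F N _).2 hθ)))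
  refine ⟨_, h₄, hθ', ?_, hC, hγ, hL, fun P => ?_⟩
  · rw [datumOfRecord₁₃Sep_pinW F N _ h₃, datumOfRecord₁₃Sep_pinZ F N _ h₂, datumOfRecord₁₃Sep_pinY F N _ h₁, datumOfRecord₁₃Sep_pinB10 F N θ h]
  · rw [hup P, Stage13Params.view₁₃B10YZW_eq]

/-- … hence EVERY admissible Stage-13 parameter with separated-range provisos presents a ₁₃CSep record at its own datum whose world is bound over the FOUR-PIN view
(package EXPOSED: any floor `Mstar`, operator layer `ops`, [B11] layer `ζ`, [IV] layer `lamW`), any window, block size `θ.L`. [cite: Balaban1989LargeFieldII, Thm 1 + (0.1) pp.355–356 (bookkeeping)] -/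
theorem exists_world_isRecordOfRecord₁₃CSep_view₁₃B10YZW (h : θ.Provisos₁₃Sep F N) (hθ : θ.Admissible F N) (Mstar : ℕ) (ops : OpsY N θ.toStage3Params Mstar)
    (ζ : ResidZ F N) (lamW : ResidW F N) {γw : ℝ} (hγw : 0 < γw ∧ γw ≤ θ.γ) :
    ∃ w : WorldP, IsRecordOfRecord₁₃CSep F N (datumOfRecord₁₃Sep F N θ h) w ∧ w.γ = γw ∧ w.L = (θ.L : ℝ) ∧
      ∀ P, w.up P = upOfRecord₅C F N (θ.view₁₃B10YZW F N Mstar ops ζ lamW) P := by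
  obtain ⟨w₀⟩ := nonempty_worldP
  exact ⟨{ w₀ with
      C := (datumOfRecord₁₃Sep F N θ h).C, γ := γw, L := (θ.L : ℝ), one_lt_L := by exact_mod_cast θ.hL.2,
      up := fun P => upOfRecord₅C F N (θ.view₁₃B10YZW F N Mstar ops ζ lamW) P },
    isRecordOfRecord₁₃CSep_view₁₃B10YZW_of_eq θ h hθ Mstar ops ζ lamW _ rfl hγw rfl (fun _ => rfl), rfl, rfl, fun _ => rfl⟩

end PinFaces

/-! ## §2 THE ∃-CURRENCY OF THE ⁗ NODES STUB — N08's conjunct at the separated-range record, the guard riding on `θ`, and the rung-1 v2 PIN `PrintedUV3V N θ.L` -/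

section Currency

/-- **AT THE DATUM OF ANY ADMISSIBLE STAGE-13 TUPLE WITH SEPARATED-RANGE PROVISOS, a world (any window height `γw`, block size `θ.L`) that IS a ₁₃CSep record of
`datumOfRecord₁₃Sep F N θ h`, bound over the [B10]-PINNED Stage-13 view, carrying N08 at every run — from the one slot instance `PrintedUV3V N θ.L`** (§0b + p491313 §1's
proviso-free pointed closer `b10_main_of_up_pinB10`). [cite: Balaban1985UV3, Thm 1 p.257, Thm 2 p.272; Balaban1989LargeFieldII, Thm 1 + (0.1) pp.355–356 (the record's world; bookkeeping)] -/
theorem exists_world₁₃CSep_b10_main_of_slot (θ : Stage13Params F N) (h : θ.Provisos₁₃Sep F N) (hθ : θ.Admissible F N) {γw : ℝ} (hγw : 0 < γw ∧ γw ≤ θ.γ)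
    (hUV : PrintedUV3V N θ.L) :
    ∃ w : WorldP, IsRecordOfRecord₁₃CSep F N (datumOfRecord₁₃Sep F N θ h) w ∧ w.γ = γw ∧ w.L = (θ.L : ℝ) ∧
      (∀ P, w.up P = upOfRecord₅C F N ((θ.pinB10 F N).toStage5₁₃ F N) P) ∧ ∀ P : B12.RunParams, Dag.B10_main (leavesP w P) := by
  obtain ⟨w, hR, hγ, hL, hup⟩ := exists_world_isRecordOfRecord₁₃CSep_pinB10 θ h hθ hγw
  exact ⟨w, hR, hγ, hL, hup, b10_main_of_up_pinB10 θ hup hUV⟩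

/-- **The four-pin twin** (package EXPOSED): at the same datum a world bound over `θ.view₁₃B10YZW Mstar ops ζ lamW` that IS a ₁₃CSep record and carries N08 at every run,
from `PrintedUV3V N θ.L` — the world at which the other nodes' pointed closers over the four-pin view apply. [cite: Balaban1985UV3, Thm 1 p.257, Thm 2 p.272; Balaban1989LargeFieldII, Thm 1 + (0.1) pp.355–356 (bookkeeping)] -/
theorem exists_world₁₃CSep_view₁₃B10YZW_b10_main_of_slot (θ : Stage13Params F N) (h : θ.Provisos₁₃Sep F N) (hθ : θ.Admissible F N) (Mstar : ℕ)
    (ops : OpsY N θ.toStage3Params Mstar) (ζ : ResidZ F N) (lamW : ResidW F N) {γw : ℝ} (hγw : 0 < γw ∧ γw ≤ θ.γ) (hUV : PrintedUV3V N θ.L) :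
    ∃ w : WorldP, IsRecordOfRecord₁₃CSep F N (datumOfRecord₁₃Sep F N θ h) w ∧ w.γ = γw ∧ w.L = (θ.L : ℝ) ∧
      (∀ P, w.up P = upOfRecord₅C F N (θ.view₁₃B10YZW F N Mstar ops ζ lamW) P) ∧ ∀ P : B12.RunParams, Dag.B10_main (leavesP w P) := by
  obtain ⟨w, hR, hγ, hL, hup⟩ := exists_world_isRecordOfRecord₁₃CSep_view₁₃B10YZW θ h hθ Mstar ops ζ lamW hγw
  exact ⟨w, hR, hγ, hL, hup, b10_main_of_up_view₁₃B10YZW θ Mstar ops ζ lamW hup hUV⟩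

/-- **THE PINNED PRESENTATION** at the separated-range record: from `θ`, its separated-range provisos, admissibility and guard, and `PrintedUV3V N θ.L` — a presenting
parameter `θ' := θ.pinB10` with provisos `h'`, THE SAME datum (`datumOfRecord₁₃Sep_pinB10`), the guard and admissibility read AT `θ'` (carrier-blind), a world bound over
`θ'.toStage5₁₃` that IS a ₁₃CSep record and carries N08 at every run, AND THE PIN READ AT `θ'` (`θ'.L = θ.L`, `rfl`). [cite: Balaban1985UV3, Thm 1 p.257, Thm 2 p.272; Balaban1989LargeFieldII, Thm 1 + (0.1) pp.355–356; Balaban1988Convergent, (3.16)–(3.22) pp.268–269 (the guard; bookkeeping)] -/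
theorem exists_pinned_presentation₁₃CSep_b10_main (θ : Stage13Params F N) (h : θ.Provisos₁₃Sep F N) (hθ : θ.Admissible F N)
    (hG : θ.ZtUnity F N ∧ θ.SlotsNondegenerate₁₃ F N) {γw : ℝ} (hγw : 0 < γw ∧ γw ≤ θ.γ) (hUV : PrintedUV3V N θ.L) :
    ∃ (θ' : Stage13Params F N) (h' : θ'.Provisos₁₃Sep F N) (w : WorldP), (θ'.ZtUnity F N ∧ θ'.SlotsNondegenerate₁₃ F N) ∧ θ'.Admissible F N ∧
      datumOfRecord₁₃Sep F N θ' h' = datumOfRecord₁₃Sep F N θ h ∧ w.C = (datumOfRecord₁₃Sep F N θ' h').C ∧ (0 < w.γ ∧ w.γ ≤ θ'.γ) ∧ w.γ = γw ∧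
      w.L = (θ'.L : ℝ) ∧ (∀ P, w.up P = upOfRecord₅C F N (θ'.toStage5₁₃ F N) P) ∧ IsRecordOfRecord₁₃CSep F N (datumOfRecord₁₃Sep F N θ h) w ∧
      (∀ P : B12.RunParams, Dag.B10_main (leavesP w P)) ∧ PrintedUV3V N θ'.L := by
  obtain ⟨w, hR, hγ, hL, hup, hN⟩ := exists_world₁₃CSep_b10_main_of_slot θ h hθ hγw hUV
  refine ⟨θ.pinB10 F N, h.pinB10, w, (guard_pinB10_iff θ).2 hG, (Stage13Params.pinB10_admissible_iff F N θ).2 hθ,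
    datumOfRecord₁₃Sep_pinB10 F N θ h, ?_, ?_, hγ, hL, fun P => (hup P).trans (by rw [Stage13Params.toStage5₁₃_pinB10]), hR, hN, hUV⟩
  · rw [datumOfRecord₁₃Sep_pinB10 F N θ h]; exact construction_eq_of_isRecordOfRecord₁₃CSep hR
  · rw [hγ]; exact hγw

/-- **THE FOUR-PIN PRESENTATION** at the separated-range record (package EXPOSED): presenting parameter `θ' := (((θ.pinB10).pinY (Y9OfRecord …)).pinZ (Z11OfRecord ζ)).pinW
(WOfRecord₁₃ θ lamW)` — THE SAME datum (the four `datumOfRecord₁₃Sep_pin<G>`), guard and admissibility read AT `θ'` (pin-blind), a world bound over `θ'.toStage5₁₃`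
(= `θ.view₁₃B10YZW …`, `view₁₃B10YZW_eq`) that IS a ₁₃CSep record of `datumOfRecord₁₃Sep θ h` and carries N08 at every run — from `PrintedUV3V N θ.L`, WITH THE PIN READ AT `θ'`.
[cite: Balaban1985UV3, Thm 1 p.257, Thm 2 p.272; Balaban1989LargeFieldII, Thm 1 + (0.1) pp.355–356; Balaban1988Convergent, (3.16)–(3.22) pp.268–269 (bookkeeping)] -/
theorem exists_pinned4_presentation₁₃CSep_b10_main (θ : Stage13Params F N) (h : θ.Provisos₁₃Sep F N) (hθ : θ.Admissible F N)
    (hG : θ.ZtUnity F N ∧ θ.SlotsNondegenerate₁₃ F N) (Mstar : ℕ) (ops : OpsY N θ.toStage3Params Mstar) (ζ : ResidZ F N) (lamW : ResidW F N) {γw : ℝ}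
    (hγw : 0 < γw ∧ γw ≤ θ.γ) (hUV : PrintedUV3V N θ.L) :
    ∃ (θ' : Stage13Params F N) (h' : θ'.Provisos₁₃Sep F N) (w : WorldP), (θ'.ZtUnity F N ∧ θ'.SlotsNondegenerate₁₃ F N) ∧ θ'.Admissible F N ∧
      datumOfRecord₁₃Sep F N θ' h' = datumOfRecord₁₃Sep F N θ h ∧ w.C = (datumOfRecord₁₃Sep F N θ' h').C ∧ (0 < w.γ ∧ w.γ ≤ θ'.γ) ∧ w.γ = γw ∧
      w.L = (θ'.L : ℝ) ∧ (∀ P, w.up P = upOfRecord₅C F N (θ'.toStage5₁₃ F N) P) ∧ (∀ P, w.up P = upOfRecord₅C F N (θ.view₁₃B10YZW F N Mstar ops ζ lamW) P) ∧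
      IsRecordOfRecord₁₃CSep F N (datumOfRecord₁₃Sep F N θ h) w ∧ (∀ P : B12.RunParams, Dag.B10_main (leavesP w P)) ∧ PrintedUV3V N θ'.L := by
  obtain ⟨w, hR, hγ, hL, hup, hN⟩ := exists_world₁₃CSep_view₁₃B10YZW_b10_main_of_slot θ h hθ Mstar ops ζ lamW hγw hUV
  have h₁ : (θ.pinB10 F N).Provisos₁₃Sep F N := h.pinB10
  have h₂ : ((θ.pinB10 F N).pinY F N (Y9OfRecord N θ.toStage3Params Mstar ops)).Provisos₁₃Sep F N := h₁.pinY _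
  have h₃ : (((θ.pinB10 F N).pinY F N (Y9OfRecord N θ.toStage3Params Mstar ops)).pinZ F N (Z11OfRecord F N ζ)).Provisos₁₃Sep F N := h₂.pinZ _
  have h₄ : ((((θ.pinB10 F N).pinY F N (Y9OfRecord N θ.toStage3Params Mstar ops)).pinZ F N (Z11OfRecord F N ζ)).pinW F N (WOfRecord₁₃ F N θ lamW)).Provisos₁₃Sep F N :=
    h₃.pinW _
  have hD : datumOfRecord₁₃Sep F N _ h₄ = datumOfRecord₁₃Sep F N θ h := by
    rw [datumOfRecord₁₃Sep_pinW F N _ h₃, datumOfRecord₁₃Sep_pinZ F N _ h₂, datumOfRecord₁₃Sep_pinY F N _ h₁, datumOfRecord₁₃Sep_pinB10 F N θ h]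
  refine ⟨_, h₄, w,
    (guard_pinW_iff _ _).2 ((guard_pinZ_iff _ _).2 ((guard_pinY_iff _ _).2 ((guard_pinB10_iff θ).2 hG))),
    (Stage13Params.pinW_admissible_iff F N _ _).2 ((Stage13Params.pinZ_admissible_iff F N _ _).2
      ((Stage13Params.pinY_admissible_iff F N _ _).2 ((Stage13Params.pinB10_admissible_iff F N _).2 hθ))),
    hD, ?_, ?_, hγ, hL, fun P => (hup P).trans (by rw [Stage13Params.view₁₃B10YZW_eq]), hup, hR, hN, hUV⟩
  · rw [hD]; exact construction_eq_of_isRecordOfRecord₁₃CSep hR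
  · rw [hγ]; exact hγw

/-- **«K0⁗'s ANTECEDENT ⟹ N08's CONJUNCT OF RUNG 1 v2, WITH ITS PIN»**, generic `N`: from `∃ θ, Provisos₁₃Sep ∧ (ZtUnity ∧ SlotsNondegenerate₁₃) ∧ Admissible` at `F`
(HYPOTHESIS `hI`, the guard bundled as ONE conjunct and carried to the SAME `θ` untouched) and the slot of record at every odd `L > 1` (HYPOTHESIS `hUV`, the node's object
gap), SOME guarded admissible tuple `θ`, separated-range provisos `h` and world `w` with `IsRecordOfRecord₁₃CSep F N (datumOfRecord₁₃Sep F N θ h) w`, `Dag.B10_main` at every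
run (`γw := θ.γ`), AND `PrintedUV3V N θ.L` (plan's rung 1 v2 pin, read at this `θ`).  NOT the stub (twelve conjuncts missing), NOT a discharge. [cite: Balaban1985UV3, Thm 1 p.257, Thm 2 p.272; Balaban1989LargeFieldII, Thm 1 + (0.1) pp.355–356; Balaban1988Convergent, (3.16)–(3.22) pp.268–269 (bookkeeping)] -/
theorem exists_guarded_record₁₃CSep_b10_main_of_inhabited13Sep
    (hI : ∃ θ : Stage13Params F N, θ.Provisos₁₃Sep F N ∧ (θ.ZtUnity F N ∧ θ.SlotsNondegenerate₁₃ F N) ∧ θ.Admissible F N)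
    (hUV : ∀ L : ℕ, Odd L → 1 < L → PrintedUV3V N L) :
    ∃ (θ : Stage13Params F N) (h : θ.Provisos₁₃Sep F N) (w : WorldP), (θ.ZtUnity F N ∧ θ.SlotsNondegenerate₁₃ F N) ∧ θ.Admissible F N ∧
      IsRecordOfRecord₁₃CSep F N (datumOfRecord₁₃Sep F N θ h) w ∧ (∀ P : B12.RunParams, Dag.B10_main (leavesP w P)) ∧ PrintedUV3V N θ.L := by
  obtain ⟨θ, h, hG, hθ⟩ := hI
  have hUVθ : PrintedUV3V N θ.L := hUV θ.L θ.hL.1 θ.hL.2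
  obtain ⟨w, hR, -, -, -, hN⟩ := exists_world₁₃CSep_b10_main_of_slot θ h hθ ⟨hθ.toStage9.gamma_pos, le_rfl⟩ hUVθ
  exact ⟨θ, h, w, hG, hθ, hR, hN, hUVθ⟩

/-- **THE SAME AT THE GROUP OF RECORD `N = 2`, hypothesis = the ⁗ K0 text VERBATIM** (plan's `Record13SepInhabited` body at `F` under `mk_skel18.py`'s token map:
`∃ θ : Stage13Params F 2, θ.Provisos₁₃Sep F 2 ∧ (θ.ZtUnity F 2 ∧ θ.SlotsNondegenerate₁₃ F 2) ∧ θ.Admissible F 2`): N08's conjunct of rung 1 v2 `NodesAtSomeRecord13P`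
from it and the slot at every odd `L > 1`, with the pin `PrintedUV3V 2 θ.L`.  NOT the stub, NOT a discharge. [cite: Balaban1985UV3, Thm 1 p.257, Thm 2 p.272; Balaban1989LargeFieldII, Thm 1 + (0.1) pp.355–356 (bookkeeping)] -/
theorem exists_guarded_record₁₃CSep_b10_main_of_inhabited13Sep_two (F : T4Family)
    (hI : ∃ θ : Stage13Params F 2, θ.Provisos₁₃Sep F 2 ∧ (θ.ZtUnity F 2 ∧ θ.SlotsNondegenerate₁₃ F 2) ∧ θ.Admissible F 2)
    (hUV : ∀ L : ℕ, Odd L → 1 < L → PrintedUV3V 2 L) :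
    ∃ (θ : Stage13Params F 2) (h : θ.Provisos₁₃Sep F 2) (w : WorldP), (θ.ZtUnity F 2 ∧ θ.SlotsNondegenerate₁₃ F 2) ∧ θ.Admissible F 2 ∧
      IsRecordOfRecord₁₃CSep F 2 (datumOfRecord₁₃Sep F 2 θ h) w ∧ (∀ P : B12.RunParams, Dag.B10_main (leavesP w P)) ∧ PrintedUV3V 2 θ.L :=
  exists_guarded_record₁₃CSep_b10_main_of_inhabited13Sep hI hUV

/-- **BRIDGE: the ‴ ANTECEDENT STILL SERVES** — from `∃ θ, Provisos₁₃ ∧ (guard) ∧ Admissible` (the deprecated key, any inhabitant of record so far) and the slot at every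
odd `L > 1`, N08's conjunct at the SEPARATED-RANGE record with its pin (def-T's one-way map `Provisos₁₃.toSep`; the datum is the same term by `datumOfRecord₁₃Sep_toSep`).
[cite: Balaban1985UV3, Thm 1 p.257, Thm 2 p.272; Balaban1988Convergent, (2.28) p.259; Balaban1985RegularSpaces, (1.3)–(1.6) p.77 (bookkeeping)] -/
theorem exists_guarded_record₁₃CSep_b10_main_of_inhabited13
    (hI : ∃ θ : Stage13Params F N, θ.Provisos₁₃ F N ∧ (θ.ZtUnity F N ∧ θ.SlotsNondegenerate₁₃ F N) ∧ θ.Admissible F N)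
    (hUV : ∀ L : ℕ, Odd L → 1 < L → PrintedUV3V N L) :
    ∃ (θ : Stage13Params F N) (h : θ.Provisos₁₃Sep F N) (w : WorldP), (θ.ZtUnity F N ∧ θ.SlotsNondegenerate₁₃ F N) ∧ θ.Admissible F N ∧
      IsRecordOfRecord₁₃CSep F N (datumOfRecord₁₃Sep F N θ h) w ∧ (∀ P : B12.RunParams, Dag.B10_main (leavesP w P)) ∧ PrintedUV3V N θ.L := by
  obtain ⟨θ, h, hG, hθ⟩ := hI
  exact exists_guarded_record₁₃CSep_b10_main_of_inhabited13Sep ⟨θ, h.toSep, hG, hθ⟩ hUV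

end Currency

/-! ## §3 ON THE STAGE-13 WITNESS LINE OF RECORD `θ₁₃ = theta13LiveOfRecord F N` (block size `F.L`, window `γ = 1∕2`) — N08's share costs `PrintedUV3V N F.L`; the guard
is K0a's HYPOTHESIS-FREE row P12 (`Record13LiveSelectorFamily` v1.1) -/

section WitnessLine
variable (F N)

/-- **N08's SHARE OF THE ⁗ NODES STUB ON THE WITNESS LINE OF RECORD COSTS THE SINGLE PROP `PrintedUV3V N F.L`** (plus K0⁗'s own separated-range provisos `hP` at `θ₁₃`,
HYPOTHESIS; admissibility is K0a's THEOREM `admissible_theta13LiveOfRecord`): a world of `datumOfRecord₁₃Sep F N θ₁₃ hP` (`w.γ = 1∕2`, `w.L = F.L`), bound over the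
[B10]-pinned view of `θ₁₃`, that is a ₁₃CSep record and carries N08 at every run.  At `N = 2`: [Balaban1985UV3] Thm 1-compact ∧ Thm 2 with their printed ∃-prefix for SU(2)
at the family's block size `F.L`, at some version of print's transformations. [cite: Balaban1985UV3, Thm 1 p.257, Thm 2 p.272; Balaban1989LargeFieldII, Thm 1 + (0.1) pp.355–356; Balaban1987RG1, (0.21) p.256 (bookkeeping)] -/
theorem exists_world₁₃CSep_b10_main_at_theta13LiveOfRecord (hP : (theta13LiveOfRecord F N).Provisos₁₃Sep F N) (hUV : PrintedUV3V N F.L) :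
    ∃ w : WorldP, IsRecordOfRecord₁₃CSep F N (datumOfRecord₁₃Sep F N (theta13LiveOfRecord F N) hP) w ∧ w.γ = 1 / 2 ∧ w.L = (F.L : ℝ) ∧
      (∀ P, w.up P = upOfRecord₅C F N (((theta13LiveOfRecord F N).pinB10 F N).toStage5₁₃ F N) P) ∧
      ∀ P : B12.RunParams, Dag.B10_main (leavesP w P) :=
  exists_world₁₃CSep_b10_main_of_slot (theta13LiveOfRecord F N) hP (admissible_theta13LiveOfRecord F N) (γw := 1 / 2)
    ⟨one_half_pos, (theta13LiveOfRecord_γ F N).symm.le⟩ hUV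

/-- **N08's CONJUNCT OF RUNG 1 v2, WITNESSED AT `θ₁₃` OF RECORD, `N = 2`, WITH ITS PIN** — from K0⁗'s open rows at the witness (`hP : θ₁₃.Provisos₁₃Sep F 2`, HYPOTHESIS)
and `PrintedUV3V 2 F.L`: the guard is K0a's HYPOTHESIS-FREE `ztUnity_theta13LiveOfRecord` ∕ `slotsNondegenerate₁₃_theta13LiveOfRecord_of_hasResiduals` and admissibility
its `admissible_theta13LiveOfRecord`, BY NAME (no proviso row read).  NOT the stub, NOT a discharge. [cite: Balaban1985UV3, Thm 1 p.257, Thm 2 p.272; Balaban1988Convergent, Thm 1 p.262, (3.16)–(3.22) pp.268–269; Balaban1989LargeFieldI, (0.3)–(0.4) p.176 (bookkeeping)] -/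
theorem exists_guarded_record₁₃CSep_b10_main_of_theta13Live_provisosSep_two (F : T4Family) (hP : (theta13LiveOfRecord F 2).Provisos₁₃Sep F 2)
    (hUV : PrintedUV3V 2 F.L) :
    ∃ (θ : Stage13Params F 2) (h : θ.Provisos₁₃Sep F 2) (w : WorldP), (θ.ZtUnity F 2 ∧ θ.SlotsNondegenerate₁₃ F 2) ∧ θ.Admissible F 2 ∧
      IsRecordOfRecord₁₃CSep F 2 (datumOfRecord₁₃Sep F 2 θ h) w ∧ (∀ P : B12.RunParams, Dag.B10_main (leavesP w P)) ∧ PrintedUV3V 2 θ.L := by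
  obtain ⟨w, hR, -, -, -, hN⟩ := exists_world₁₃CSep_b10_main_at_theta13LiveOfRecord F 2 hP hUV
  exact ⟨_, hP, w, ⟨ztUnity_theta13LiveOfRecord F 2, slotsNondegenerate₁₃_theta13LiveOfRecord_of_hasResiduals F 2⟩,
    admissible_theta13LiveOfRecord F 2, hR, hN, hUV⟩

end WitnessLine

/-! ## §4 AT K0a's STAGE-13 WITNESS FAMILIES — the all-numerics family `θ₁₃(n, ε₂₉)` (`γ = n.γ`) and the two-letter family `θ₁₃(ε₀, ε₂₉)` (`γ = 1∕2`), block size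
`F.L`; separated-range provisos OPAQUE, guard HYPOTHESIS-FREE -/

section Numerics
variable (F : T4Family) (N : ℕ) [NeZero N] {n : Stage12Numerics} {ε₂₉ : ℝ}

/-- **N08's SHARE OF THE ⁗ NODES STUB AT ANY MEMBER `θ₁₃(n, ε₂₉)` COSTS THE SINGLE PROP `PrintedUV3V N F.L`** (plus the member's separated-range provisos `hP`, HYPOTHESIS, and
the two displayed signs `n.Pos`, `0 < ε₂₉` under which K0a's `admissible_theta13LiveOfNumerics` gives admissibility): a world of the member's separated-range datum (`w.γ = n.γ`,
`w.L = F.L`), bound over the [B10]-pinned Stage-13 view of the member, that IS a ₁₃CSep record and carries N08 at every run (§2 `exists_world₁₃CSep_b10_main_of_slot`).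
[cite: Balaban1985UV3, Thm 1 p.257, Thm 2 p.272; Balaban1989LargeFieldII, Thm 1 + (0.1) pp.355–356; Balaban1987RG1, (0.21) p.256, (2.9) p.266 (bookkeeping)] -/
theorem exists_world₁₃CSep_b10_main_at_theta13LiveOfNumerics (hn : n.Pos) (hε' : 0 < ε₂₉)
    (hP : (theta13LiveOfNumerics F N n ε₂₉ (zeta316OfRecord F N n.ν n.τ9.M n.A₁) (RzOfRecord F N) (ZtOfRecord F N)).Provisos₁₃Sep F N)
    (hUV : PrintedUV3V N F.L) :
    ∃ w : WorldP,
      IsRecordOfRecord₁₃CSep F N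
          (datumOfRecord₁₃Sep F N (theta13LiveOfNumerics F N n ε₂₉ (zeta316OfRecord F N n.ν n.τ9.M n.A₁) (RzOfRecord F N) (ZtOfRecord F N)) hP) w ∧
        w.γ = n.γ ∧ w.L = (F.L : ℝ) ∧
        (∀ P, w.up P = upOfRecord₅C F N
          (((theta13LiveOfNumerics F N n ε₂₉ (zeta316OfRecord F N n.ν n.τ9.M n.A₁) (RzOfRecord F N) (ZtOfRecord F N)).pinB10 F N).toStage5₁₃ F N) P) ∧
        ∀ P : B12.RunParams, Dag.B10_main (leavesP w P) :=
  have hθ := admissible_theta13LiveOfNumerics F N (zeta316OfRecord F N n.ν n.τ9.M n.A₁) (RzOfRecord F N) (ZtOfRecord F N) hn hε'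
  exists_world₁₃CSep_b10_main_of_slot _ hP hθ (γw := n.γ) ⟨hθ.toStage9.gamma_pos, le_rfl⟩ hUV

/-- **N08's CONJUNCT OF RUNG 1 v2, WITNESSED AT THE MEMBER `θL F n ε₂₉`, `N = 2`, WITH ITS PIN** — from the member's separated-range provisos (`hP`, HYPOTHESIS), the signs
`n.Pos`, `0 < ε₂₉`, and `PrintedUV3V 2 F.L`: the guard is K0a's HYPOTHESIS-FREE `ztUnity_theta13LiveOfNumerics` ∕ `slotsNondegenerate₁₃_theta13LiveOfNumerics_of_hasResiduals`
and admissibility its `admissible_theta13LiveOfNumerics`, BY NAME.  NOT the stub, NOT a discharge. [cite: Balaban1985UV3, Thm 1 p.257, Thm 2 p.272; Balaban1988Convergent, Thm 1 p.262, (3.16)–(3.22) pp.268–269; Balaban1989LargeFieldI, (0.3)–(0.4) p.176 (bookkeeping)] -/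
theorem exists_guarded_record₁₃CSep_b10_main_of_theta13Numerics_provisosSep_two (F : T4Family) {n : Stage12Numerics} {ε₂₉ : ℝ} (hn : n.Pos)
    (hε' : 0 < ε₂₉)
    (hP : (theta13LiveOfNumerics F 2 n ε₂₉ (zeta316OfRecord F 2 n.ν n.τ9.M n.A₁) (RzOfRecord F 2) (ZtOfRecord F 2)).Provisos₁₃Sep F 2)
    (hUV : PrintedUV3V 2 F.L) :
    ∃ (θ : Stage13Params F 2) (h : θ.Provisos₁₃Sep F 2) (w : WorldP), (θ.ZtUnity F 2 ∧ θ.SlotsNondegenerate₁₃ F 2) ∧ θ.Admissible F 2 ∧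
      IsRecordOfRecord₁₃CSep F 2 (datumOfRecord₁₃Sep F 2 θ h) w ∧ (∀ P : B12.RunParams, Dag.B10_main (leavesP w P)) ∧ PrintedUV3V 2 θ.L := by
  obtain ⟨w, hR, -, -, -, hN⟩ := exists_world₁₃CSep_b10_main_at_theta13LiveOfNumerics F 2 hn hε' hP hUV
  exact ⟨_, hP, w, ⟨ztUnity_theta13LiveOfNumerics F 2 n ε₂₉, slotsNondegenerate₁₃_theta13LiveOfNumerics_of_hasResiduals F 2 n ε₂₉⟩,
    admissible_theta13LiveOfNumerics F 2 _ _ _ hn hε', hR, hN, hUV⟩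

end Numerics

section Family₂
variable (F : T4Family) (N : ℕ) [NeZero N] {ε₀ ε₂₉ : ℝ}

/-- **N08's SHARE AT ANY MEMBER `θ₁₃(ε₀, ε₂₉)` OF THE TWO-LETTER FAMILY COSTS `PrintedUV3V N F.L`** (plus the member's separated-range provisos `hP` and the signs `0 < ε₀`,
`0 < ε₂₉`; admissibility is K0a's `admissible_theta13LiveOfFamily₂`): a world of the member's separated-range datum (`w.γ = 1∕2`, `w.L = F.L`) bound over the [B10]-pinned view,
a ₁₃CSep record carrying N08 at every run. [cite: Balaban1985UV3, Thm 1 p.257, Thm 2 p.272; Balaban1989LargeFieldII, Thm 1 + (0.1) pp.355–356; Balaban1987RG1, (1.2) p.260, (2.9) p.266 (bookkeeping)] -/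
theorem exists_world₁₃CSep_b10_main_at_theta13LiveOfFamily₂ (hε : 0 < ε₀) (hε' : 0 < ε₂₉)
    (hP : (theta13LiveOfFamily₂ F N ε₀ ε₂₉ (zeta316OfRecord F N (numerics7OfFamily ε₀) 1 1) (RzOfRecord F N) (ZtOfRecord F N)).Provisos₁₃Sep F N)
    (hUV : PrintedUV3V N F.L) :
    ∃ w : WorldP,
      IsRecordOfRecord₁₃CSep F N
          (datumOfRecord₁₃Sep F N (theta13LiveOfFamily₂ F N ε₀ ε₂₉ (zeta316OfRecord F N (numerics7OfFamily ε₀) 1 1) (RzOfRecord F N) (ZtOfRecord F N)) hP) w ∧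
        w.γ = 1 / 2 ∧ w.L = (F.L : ℝ) ∧
        (∀ P, w.up P = upOfRecord₅C F N
          (((theta13LiveOfFamily₂ F N ε₀ ε₂₉ (zeta316OfRecord F N (numerics7OfFamily ε₀) 1 1) (RzOfRecord F N) (ZtOfRecord F N)).pinB10 F N).toStage5₁₃ F N) P) ∧
        ∀ P : B12.RunParams, Dag.B10_main (leavesP w P) :=
  exists_world₁₃CSep_b10_main_of_slot _ hP (admissible_theta13LiveOfFamily₂ F N _ _ _ hε hε') (γw := 1 / 2)
    ⟨one_half_pos, (theta13LiveOfFamily₂_γ F N ε₀ ε₂₉ _ _ _).symm.le⟩ hUV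

/-- **N08's CONJUNCT OF RUNG 1 v2, WITNESSED AT THE MEMBER `θ₁₃(ε₀, ε₂₉)`, `N = 2`, WITH ITS PIN** — from the member's separated-range provisos (`hP`, HYPOTHESIS), `0 < ε₀`,
`0 < ε₂₉` and `PrintedUV3V 2 F.L`; the guard is K0a's HYPOTHESIS-FREE `ztUnity_theta13LiveOfFamily₂` ∕ `slotsNondegenerate₁₃_theta13LiveOfFamily₂_of_hasResiduals`, admissibility
its `admissible_theta13LiveOfFamily₂`, BY NAME.  NOT the stub, NOT a discharge. [cite: Balaban1985UV3, Thm 1 p.257, Thm 2 p.272; Balaban1988Convergent, Thm 1 p.262, (3.16)–(3.22) pp.268–269; Balaban1989LargeFieldI, (0.3)–(0.4) p.176 (bookkeeping)] -/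
theorem exists_guarded_record₁₃CSep_b10_main_of_theta13Family₂_provisosSep_two (F : T4Family) {ε₀ ε₂₉ : ℝ} (hε : 0 < ε₀) (hε' : 0 < ε₂₉)
    (hP : (theta13LiveOfFamily₂ F 2 ε₀ ε₂₉ (zeta316OfRecord F 2 (numerics7OfFamily ε₀) 1 1) (RzOfRecord F 2) (ZtOfRecord F 2)).Provisos₁₃Sep F 2)
    (hUV : PrintedUV3V 2 F.L) :
    ∃ (θ : Stage13Params F 2) (h : θ.Provisos₁₃Sep F 2) (w : WorldP), (θ.ZtUnity F 2 ∧ θ.SlotsNondegenerate₁₃ F 2) ∧ θ.Admissible F 2 ∧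
      IsRecordOfRecord₁₃CSep F 2 (datumOfRecord₁₃Sep F 2 θ h) w ∧ (∀ P : B12.RunParams, Dag.B10_main (leavesP w P)) ∧ PrintedUV3V 2 θ.L := by
  obtain ⟨w, hR, -, -, -, hN⟩ := exists_world₁₃CSep_b10_main_at_theta13LiveOfFamily₂ F 2 hε hε' hP hUV
  exact ⟨_, hP, w, ⟨ztUnity_theta13LiveOfFamily₂ F 2 ε₀ ε₂₉, slotsNondegenerate₁₃_theta13LiveOfFamily₂_of_hasResiduals F 2 ε₀ ε₂₉⟩,
    admissible_theta13LiveOfFamily₂ F 2 _ _ _ hε hε', hR, hN, hUV⟩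

end Family₂

end Summit.QuantumFields.YangMills.BalabanUVNodes.N08AtRecord13Sep

end
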